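import Literature.NumberTheory.Automorphic.QuadraticRestrictionOfScalars
import Literature.RepresentationTheory.HeisenbergGroup.SchrodingerSiegelParabolic
import Mathlib.LinearAlgebra.Matrix.SesquilinearForm
import Mathlib.LinearAlgebra.Matrix.ToLin
import Mathlib.LinearAlgebra.Matrix.GeneralLinearGroup.Defs
import HarnessLib

/-!
# Unitary groups inside symplectic groups: `U(h) ⊂ Sp(Res_{S/R} Sⁿ, im h)` and the dual pair
`U(h_V) × U(h_W) → U(h_V ⊗ h_W)` (Weil 1964 n° 5; Mœglin–Vignéras–Waldspurger Ch. 1 I.17–I.19; Gelbart–Rogawski 1991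
§3.1: "`W = Res_{E/F} V` with the symplectic form `Tr_{E/F}`-part of `Φ`, `G = U(V) ⊂ Sp(W)`")

Topic `NumberTheory/Automorphic`; namespace `Literature.NumberTheory.Automorphic.UnitaryGroup` (continues
`QuadraticRestrictionOfScalars`). Definitions and proved lemmas only: **no named facts, 0 proof holes**.

**Setting (pure algebra).** Quadratic coordinates `IsQuadraticCoordinates φ Ψ δ d` of `QuadraticRestrictionOfScalars`
(`S = φ(R) ⊕ φ(R) δ`, `δ² = φ d`), an endomorphism `σ : S →+* S` with `σ ∘ φ = φ` and `σ δ = -δ` (the conjugation of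
`S/R`), and a form matrix `H = T.map φ` with `T ∈ Mₙ(R)` symmetric (an `R`-rational Gram matrix; every hermitian form
over a quadratic field extension has one in an orthogonal basis, and `UnitaryGroupFormTransport` moves between Gram
matrices). The tree's unitary group is `unitaryGroupOfForm σ H = {g ∈ GLₙ(S) | (σ g)ᵀ H g = H}`
(`UnitaryGroupAutomorphicRep`), the group of the hermitian pairing `h(x, y) = (σ x)ᵀ H y` (`hermForm`).

* §1 `σ`-compatibility of the coordinates: `re (σ z) = re z`, `im (σ z) = -im z`; `re/im (φ t · z) = t · re/im z`;
  the trace `z + σ z = 2 re z` and **`Tr_{S/R}(δ z) = 2d · im z`** (dictionary with Gelbart–Rogawski's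
  `⟨ , ⟩ = Tr_{E/F} Φ`, `Φ = δ h` skew-hermitian: the same symplectic group as `im h`).
* §2 the coordinates of vectors `reIm : Sⁿ ≃+ Rⁿ × Rⁿ`, `x = a + b δ ↦ (a, b)`: the **`R`-rational complete
  polarisation** `Res_{S/R} Sⁿ = X ⊕ Y`, `X = Rⁿ · 1`, `Y = Rⁿ · δ`.
* §3 the **restriction-of-scalars action** `resAut : GLₙ(S) →* (Rⁿ × Rⁿ) ≃ₗ[R] (Rⁿ × Rⁿ)` (= `restrictScalars` of
  `QuadraticRestrictionOfScalars` read through `Matrix.toLin'` in the coordinates `reIm`), characterised by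
  **`resAut g (reIm x) = reIm (g x)`**, with the block formula `(a, b) ↦ (g₁ a + d g₂ b, g₂ a + g₁ b)` for
  `g = g₁ + g₂ δ`; injective.
* §4 the hermitian pairing `hermForm σ H x y = (σ ∘ x) ⬝ᵥ (H *ᵥ y)`, its invariance under `unitaryGroupOfForm σ H`,
  and the identity **`im h(x, y) = ⟪reIm x, reIm y⟫_T`** where `⟪(a, b), (a', b')⟫_T = aᵀ T b' - a'ᵀ T b` is the
  alternating form `alt (polar β_T)` of the tree's Heisenberg/Weil files (`SchrodingerSiegelParabolic`:
  `symplecticGroup B = Sp(alt B)`), `β_T = Matrix.toLinearMap₂' R T : Rⁿ →ₗ Rⁿ →ₗ R`, `β_T a b = Σ aᵢ Tᵢⱼ bⱼ`.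
  So `X` and `Y` are complementary Lagrangians and `β_T` is the induced pairing `X × Y → R`.
* §5 **`toSymplectic : unitaryGroupOfForm σ H →* symplecticGroup (polar β_T)`** for `H = T.map φ`, `Tᵀ = T`:
  `U(h)` preserves `h`, hence `im h`; injective; `toSymplectic g (reIm x) = reIm (g x)`.
* §6 the **dual pair**: `kroneckerGL : GLₙ(S) × GLₘ(S) →* GL_{n × m}(S)`, `(g, g') ↦ g ⊗ₖ g'`;
  `U(σ, H_V) × U(σ, H_W) →* U(σ, H_V ⊗ₖ H_W)` (`dualPair`; the two images commute), `(T_V ⊗ₖ T_W)` is symmetric and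
  `(T_V.map φ) ⊗ₖ (T_W.map φ) = (T_V ⊗ₖ T_W).map φ`, whence
  **`dualPairToSymplectic : U(σ, T_V.map φ) × U(σ, T_W.map φ) →* symplecticGroup (polar β_{T_V ⊗ₖ T_W})`**.

The number-field instances (`R = F, F_v, 𝔸_F^∞, 𝔸_F, ℝ`; `S = E, E ⊗_F F_v, 𝔸_E^∞, 𝔸_E, ℂ`) on the tree's carriers
`UnitaryGroup.rational / «local» / localPi / finAdelic / archLocal` are in `UnitaryGroupSymplecticCarriers`.

## Mathlib / tree

Mathlib: `Matrix.toLinearMap₂'` (`LinearAlgebra/Matrix/SesquilinearForm`), `Matrix.toLin'` (`toLin'_mul`, `toLin'_one`),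
`LinearEquiv.conj`, `LinearMap.GeneralLinearGroup.generalLinearEquiv`, `Matrix.kroneckerMap` (`mul_kronecker_mul`,
`one_kronecker_one`), `Matrix.dotProduct_mulVec`, `Matrix.vecMul_vecMul`, `Matrix.vecMul_transpose`, `RingHom.map_mulVec`.
Tree: `QuadraticRestrictionOfScalars` (`IsQuadraticCoordinates`, `QuadraticCoordinates.re/im/coords`, `restrictScalars`,
`coords_mulVec`), `UnitaryGroupAutomorphicRep` (`unitaryGroupOfForm`, `mem_unitaryGroupOfForm_iff`),
`HeisenbergGroup/SchrodingerSiegelParabolic` (`symplecticGroup`, `alt`), `HeisenbergGroup/HeisenbergGroup` (`polar`,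
`Heisenberg.PseudoSymplectic.isometries`).

## Provenance

Written under the LEAN-IN-TREE rule (2026-08-18) for the pub-hodgecm formalisation cell (model-construction sub-cell,
node W2-ι: the constructed group side `U(V) × U(W) → Sp(𝕎)` of the unitary dual pair over which the Weil-representation
consumers parametrise). Nothing in this file is a claim of the manuscripts adjudicated by that cell; every property is
proved in the kernel.

## References

* A. Weil, Sur certains groupes d'opérateurs unitaires, Acta Math. 111 (1964), n° 5 [Weil1964].
* C. Mœglin, M.-F. Vignéras, J.-L. Waldspurger, *Correspondances de Howe sur un corps p-adique*, LNM 1291 (1987),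
  Ch. 1 [MoeglinVignerasWaldspurger1987].
* S. Gelbart, J. Rogawski, L-functions and Fourier–Jacobi coefficients for the unitary group U(3), Invent. Math. 105
  (1991), §3.1 [GelbartRogawski1991].
-/

noncomputable section

open Matrix
open scoped Kronecker
open Literature.RepresentationTheory.HeisenbergGroup

namespace Literature.NumberTheory.Automorphic

namespace UnitaryGroup

variable {R S : Type*} [CommRing R] [CommRing S]

/-! ## 1. `σ`-compatibility of quadratic coordinates -/

namespace IsQuadraticCoordinates

open QuadraticCoordinates

variable {φ : R →+* S} {Ψ : (R × R) ≃+ S} {δ : S} {d : R} (h : IsQuadraticCoordinates φ Ψ δ d)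
include h

/-- `re (φ t · z) = t · re z`. [folklore] -/
theorem re_map_mul (t : R) (z : S) : re Ψ (φ t * z) = t * re Ψ z := by
  rw [h.re_mul, h.re_map, h.im_map, zero_mul, mul_zero, add_zero]

/-- `im (φ t · z) = t · im z`. [folklore] -/
theorem im_map_mul (t : R) (z : S) : im Ψ (φ t * z) = t * im Ψ z := by
  rw [h.im_mul, h.re_map, h.im_map, zero_mul, add_zero]

/-- **`re (σ z) = re z`** for an endomorphism `σ` fixing `φ(R)` with `σ δ = -δ` (the conjugation). [folklore] -/
theorem re_conj {σ : S →+* S} (hσφ : ∀ a, σ (φ a) = φ a) (hσδ : σ δ = -δ) (z : S) : re Ψ (σ z) = re Ψ z := by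
  conv_lhs => rw [← h.re_add_im z]
  rw [map_add, map_mul, hσφ, hσφ, hσδ, mul_neg, ← neg_mul, ← map_neg, h.re_eq]

/-- **`im (σ z) = -im z`** for an endomorphism `σ` fixing `φ(R)` with `σ δ = -δ`. [folklore] -/
theorem im_conj {σ : S →+* S} (hσφ : ∀ a, σ (φ a) = φ a) (hσδ : σ δ = -δ) (z : S) : im Ψ (σ z) = -im Ψ z := by
  conv_lhs => rw [← h.re_add_im z]
  rw [map_add, map_mul, hσφ, hσφ, hσδ, mul_neg, ← neg_mul, ← map_neg, h.im_eq]

/-- **`z + σ z = 2 re z`**: the trace `Tr_{S/R}` in the coordinates. [folklore] -/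
theorem add_conj {σ : S →+* S} (hσφ : ∀ a, σ (φ a) = φ a) (hσδ : σ δ = -δ) (z : S) :
    z + σ z = φ (2 * re Ψ z) := by
  conv_lhs => rw [← h.re_add_im z]
  rw [map_add, map_mul, hσφ, hσφ, hσδ, map_mul, map_ofNat]
  ring

/-- `re (δ z) = d · im z`. [folklore] -/
theorem re_delta_mul (z : S) : re Ψ (δ * z) = d * im Ψ z := by
  rw [h.re_mul, h.re_delta, h.im_delta, zero_mul, zero_add, one_mul]

/-- **`Tr_{S/R}(δ · z) = 2 d · im z`**: Gelbart–Rogawski's symplectic form `⟨ , ⟩ = Tr_{E/F} Φ` of the skew-hermitian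
form `Φ = δ · h` is `2d` times the imaginary part `im h` used below (same symplectic group, same isotropic
subspaces). [cite: GelbartRogawski1991, §3.1 p. 454] -/
theorem trace_delta_mul {σ : S →+* S} (hσφ : ∀ a, σ (φ a) = φ a) (hσδ : σ δ = -δ) (z : S) :
    δ * z + σ (δ * z) = φ (2 * d * im Ψ z) := by
  rw [h.add_conj hσφ hσδ, h.re_delta_mul, mul_assoc]

/-- `im (σ z · (φ t · w)) = t · (re z · im w - im z · re w)`: the summand of `im h(x, y)`. [folklore] -/
theorem im_conj_mul_map_mul {σ : S →+* S} (hσφ : ∀ a, σ (φ a) = φ a) (hσδ : σ δ = -δ) (z w : S) (t : R) :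
    im Ψ (σ z * (φ t * w)) = t * (re Ψ z * im Ψ w - im Ψ z * re Ψ w) := by
  rw [h.im_mul, h.re_conj hσφ hσδ, h.im_conj hσφ hσδ, h.re_map_mul, h.im_map_mul]
  ring

end IsQuadraticCoordinates

/-! ## 2. Coordinates of vectors: `Sⁿ = Rⁿ · 1 ⊕ Rⁿ · δ` -/

namespace QuadraticCoordinates

variable (Ψ : (R × R) ≃+ S) (n : Type*)

/-- **`reIm : Sⁿ ≃+ Rⁿ × Rⁿ`**, `x ↦ (re ∘ x, im ∘ x)` with inverse `(a, b) ↦ (i ↦ Ψ (a i, b i))`: the complete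
polarisation `Res_{S/R} Sⁿ = Rⁿ · 1 ⊕ Rⁿ · δ`. [folklore] -/
def reIm : (n → S) ≃+ ((n → R) × (n → R)) where
  toFun x := (fun i => re Ψ (x i), fun i => im Ψ (x i))
  invFun p := fun i => Ψ (p.1 i, p.2 i)
  left_inv x := funext fun i => apply_re_im Ψ (x i)
  right_inv _ := Prod.ext (funext fun _ => re_apply Ψ _ _) (funext fun _ => im_apply Ψ _ _)
  map_add' x y := Prod.ext (funext fun i => map_add (re Ψ) (x i) (y i)) (funext fun i => map_add (im Ψ) (x i) (y i))

/-- First component of `reIm x`: `re ∘ x`. [folklore] -/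
@[simp] theorem reIm_apply_fst (x : n → S) (i : n) : (reIm Ψ n x).1 i = re Ψ (x i) := rfl

/-- Second component of `reIm x`: `im ∘ x`. [folklore] -/
@[simp] theorem reIm_apply_snd (x : n → S) (i : n) : (reIm Ψ n x).2 i = im Ψ (x i) := rfl

/-- `reIm⁻¹ (a, b) i = Ψ (a i, b i)`. [folklore] -/
@[simp] theorem reIm_symm_apply (p : (n → R) × (n → R)) (i : n) : (reIm Ψ n).symm p i = Ψ (p.1 i, p.2 i) := rfl

variable (R) in
/-- The regrouping `R^{n × 2} ≃ₗ[R] Rⁿ × Rⁿ`, `x ↦ (x (·, 0), x (·, 1))` (index `n × Fin 2` of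
`QuadraticRestrictionOfScalars` versus the product form `X × Y` of the Heisenberg files). [folklore] -/
def split : (n × Fin 2 → R) ≃ₗ[R] ((n → R) × (n → R)) where
  toFun x := (fun i => x (i, 0), fun i => x (i, 1))
  invFun p := fun q => ![p.1 q.1, p.2 q.1] q.2
  left_inv x := by
    funext ⟨i, k⟩
    fin_cases k <;> rfl
  right_inv p := by
    ext i <;> rfl
  map_add' x y := rfl
  map_smul' c x := rfl

/-- `split ∘ coords = reIm`. [folklore] -/
@[simp] theorem split_coords (x : n → S) : split R n (coords Ψ x) = reIm Ψ n x := rfl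

/-- `split⁻¹ ∘ reIm = coords`. [folklore] -/
@[simp] theorem split_symm_reIm (x : n → S) : (split R n).symm (reIm Ψ n x) = coords Ψ x := by
  rw [← split_coords, LinearEquiv.symm_apply_apply]

end QuadraticCoordinates

/-! ## 3. The restriction-of-scalars action of `GLₙ(S)` on `Rⁿ × Rⁿ` -/

namespace IsQuadraticCoordinates

open QuadraticCoordinates

variable {φ : R →+* S} {Ψ : (R × R) ≃+ S} {δ : S} {d : R} (h : IsQuadraticCoordinates φ Ψ δ d)
variable (n : Type*) [Fintype n] [DecidableEq n]
include h

/-- `Mₙ(S) →* End_R(Rⁿ × Rⁿ)`, `g ↦ split ∘ (restrictScalars g) ∘ split⁻¹`: the `R`-linear map `x ↦ g x` of `Sⁿ` in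
the coordinates `reIm`. [folklore] -/
def resEnd : Matrix n n S →* Module.End R ((n → R) × (n → R)) where
  toFun g := (split R n).conj (Matrix.toLin' (h.restrictScalars n g))
  map_one' := by rw [map_one, Matrix.toLin'_one, LinearEquiv.conj_id, Module.End.one_eq_id]
  map_mul' g g' := by rw [map_mul, Matrix.toLin'_mul, LinearEquiv.conj_comp, Module.End.mul_eq_comp]

/-- `resEnd g p = split (restrictScalars g · split⁻¹ p)`. [folklore] -/
theorem resEnd_apply (g : Matrix n n S) (p : (n → R) × (n → R)) :
    h.resEnd n g p = split R n (h.restrictScalars n g *ᵥ (split R n).symm p) := by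
  simp only [resEnd, MonoidHom.coe_mk, OneHom.coe_mk, LinearEquiv.conj_apply, LinearMap.coe_comp,
    LinearEquiv.coe_coe, Function.comp_apply, Matrix.toLin'_apply]

/-- **`resEnd g (reIm x) = reIm (g x)`**. [folklore] -/
theorem resEnd_reIm (g : Matrix n n S) (x : n → S) : h.resEnd n g (reIm Ψ n x) = reIm Ψ n (g *ᵥ x) := by
  rw [h.resEnd_apply, split_symm_reIm, ← h.coords_mulVec, split_coords]

/-- **The restriction-of-scalars action `GLₙ(S) →* GL_R(Rⁿ × Rⁿ)`** (as `R`-linear automorphisms of `X × Y`).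
[folklore] -/
def resAut : GL n S →* (((n → R) × (n → R)) ≃ₗ[R] ((n → R) × (n → R))) :=
  (LinearMap.GeneralLinearGroup.generalLinearEquiv R ((n → R) × (n → R))).toMonoidHom.comp
    (Units.map (h.resEnd n))

/-- The underlying linear map of `resAut g` is `resEnd g`. [folklore] -/
@[simp] theorem resAut_apply (g : GL n S) (p : (n → R) × (n → R)) :
    h.resAut n g p = h.resEnd n (g : Matrix n n S) p := rfl

/-- **`resAut g (reIm x) = reIm (g x)`**: `resAut g` is `x ↦ g x` on `Sⁿ` in the coordinates `(re, im)`. [folklore] -/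
theorem resAut_reIm (g : GL n S) (x : n → S) : h.resAut n g (reIm Ψ n x) = reIm Ψ n ((g : Matrix n n S) *ᵥ x) := by
  rw [resAut_apply, h.resEnd_reIm]

/-- **Block formula**: for `g = g₁ + g₂ δ` (`g₁ = re ∘ g`, `g₂ = im ∘ g` entrywise),
`resAut g (a, b) = (g₁ a + d · g₂ b, g₂ a + g₁ b)`. [folklore] -/
theorem resAut_apply_mk (g : GL n S) (a b : n → R) :
    h.resAut n g (a, b) =
      ((g : Matrix n n S).map (re Ψ) *ᵥ a + d • ((g : Matrix n n S).map (im Ψ) *ᵥ b),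
        (g : Matrix n n S).map (im Ψ) *ᵥ a + (g : Matrix n n S).map (re Ψ) *ᵥ b) := by
  have hab : (a, b) = reIm Ψ n ((reIm Ψ n).symm (a, b)) := ((reIm Ψ n).apply_symm_apply (a, b)).symm
  rw [hab, h.resAut_reIm]
  refine Prod.ext (funext fun i => ?_) (funext fun i => ?_)
  · simp only [reIm_apply_fst, reIm_symm_apply, Matrix.mulVec, dotProduct, map_sum, h.re_mul, re_apply, im_apply,
      Matrix.map_apply, Pi.add_apply, Pi.smul_apply, smul_eq_mul, Finset.mul_sum, ← Finset.sum_add_distrib]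
  · simp only [reIm_apply_snd, reIm_symm_apply, Matrix.mulVec, dotProduct, map_sum, h.im_mul, re_apply, im_apply,
      Matrix.map_apply, Pi.add_apply, ← Finset.sum_add_distrib]
    exact Finset.sum_congr rfl fun j _ => by ring

/-- On `GLₙ(R) ≤ GLₙ(S)` (entries in `φ(R)`) the action is diagonal: `resAut (a ⊗ 1) (p, q) = (a p, a q)` — the Levi
factor `GL(X)` of the Siegel parabolic acts through `a ↦ (a, a)` in these coordinates (`β_T (a p) q = β_T p (aᵀ q)`).
[folklore] -/
theorem resAut_map (a : GL n R) (p q : n → R) :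
    h.resAut n (Matrix.GeneralLinearGroup.map φ a) (p, q) = ((a : Matrix n n R) *ᵥ p, (a : Matrix n n R) *ᵥ q) := by
  rw [h.resAut_apply_mk]
  have hre : ((Matrix.GeneralLinearGroup.map φ a : GL n S) : Matrix n n S).map (re Ψ) = (a : Matrix n n R) := by
    ext i j
    exact h.re_map (a i j)
  have him : ((Matrix.GeneralLinearGroup.map φ a : GL n S) : Matrix n n S).map (im Ψ) = 0 := by
    ext i j
    exact h.im_map (a i j)
  rw [hre, him, Matrix.zero_mulVec, Matrix.zero_mulVec, smul_zero, add_zero, zero_add]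

/-- `resAut` is injective (`GLₙ(S)` acts faithfully on `Res Sⁿ`). [folklore] -/
theorem resAut_injective : Function.Injective (h.resAut n) := fun g g' hgg' => by
  refine Units.ext (Matrix.toLin'.injective (LinearMap.ext fun x => ?_))
  rw [Matrix.toLin'_apply, Matrix.toLin'_apply]
  apply (reIm Ψ n).injective
  rw [← h.resAut_reIm, ← h.resAut_reIm, hgg']

end IsQuadraticCoordinates

/-! ## 4. The hermitian pairing and its imaginary part -/

section HermForm

variable {n : Type*} [Fintype n]

/-- **The hermitian pairing `h(x, y) = (σ x)ᵀ H y = Σᵢⱼ σ(xᵢ) Hᵢⱼ yⱼ`** of the form matrix `H` with respect to `σ`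
(the pairing whose isometry group is `unitaryGroupOfForm σ H`). [cite: Mok2014, §1 Notation p. 5] -/
def hermForm (σ : S →+* S) (H : Matrix n n S) (x y : n → S) : S := (⇑σ ∘ x) ⬝ᵥ (H *ᵥ y)

/-- Unfolding `h(x, y) = (σ ∘ x) ⬝ᵥ (H *ᵥ y)`. [folklore] -/
theorem hermForm_apply (σ : S →+* S) (H : Matrix n n S) (x y : n → S) :
    hermForm σ H x y = (⇑σ ∘ x) ⬝ᵥ (H *ᵥ y) := rfl

/-- **`U(σ, H)` preserves `h`**: `(σ g)ᵀ H g = H ⇒ h(g x, g y) = h(x, y)`. [folklore] -/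
theorem hermForm_mulVec (σ : S →+* S) {H g : Matrix n n S} (hg : (g.map σ)ᵀ * H * g = H) (x y : n → S) :
    hermForm σ H (g *ᵥ x) (g *ᵥ y) = hermForm σ H x y := by
  have h1 : (⇑σ ∘ (g *ᵥ x)) = g.map σ *ᵥ (⇑σ ∘ x) := funext fun i => RingHom.map_mulVec σ g x i
  rw [hermForm, hermForm, h1]
  calc (g.map σ *ᵥ (⇑σ ∘ x)) ⬝ᵥ (H *ᵥ (g *ᵥ y))
      = (((⇑σ ∘ x) ᵥ* (g.map σ)ᵀ) ᵥ* H ᵥ* g) ⬝ᵥ y := by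
        rw [Matrix.vecMul_transpose, Matrix.dotProduct_mulVec, Matrix.dotProduct_mulVec]
    _ = ((⇑σ ∘ x) ᵥ* ((g.map σ)ᵀ * H * g)) ⬝ᵥ y := by rw [Matrix.vecMul_vecMul, Matrix.vecMul_vecMul, Matrix.mul_assoc]
    _ = (⇑σ ∘ x) ⬝ᵥ (H *ᵥ y) := by rw [hg, Matrix.dotProduct_mulVec]

end HermForm

namespace IsQuadraticCoordinates

open QuadraticCoordinates

variable {φ : R →+* S} {Ψ : (R × R) ≃+ S} {δ : S} {d : R} (h : IsQuadraticCoordinates φ Ψ δ d)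
variable (n : Type*) [Fintype n] [DecidableEq n]
include h

/-- **`im h(x, y) = aᵀ T b' - a'ᵀ T b`** for `H = T ⊗ 1` (`T ∈ Mₙ(R)` symmetric), `x = a + b δ`, `y = a' + b' δ`:
the imaginary part of the hermitian pairing is the alternating form `alt (polar β_T)` of the Heisenberg files on the
polarisation `Rⁿ × Rⁿ`, with `β_T = Matrix.toLinearMap₂' R T`. [cite: GelbartRogawski1991, §3.1 p. 454] -/
theorem im_hermForm_map {T : Matrix n n R} (hT : T.IsSymm) {σ : S →+* S} (hσφ : ∀ a, σ (φ a) = φ a)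
    (hσδ : σ δ = -δ) (x y : n → S) :
    im Ψ (hermForm σ (T.map φ) x y) = alt (polar (Matrix.toLinearMap₂' R T)) (reIm Ψ n x) (reIm Ψ n y) := by
  have hT' : ∀ i j, T j i = T i j := fun i j => by
    simpa only [Matrix.transpose_apply] using congrFun (congrFun hT i) j
  simp only [hermForm, dotProduct, Matrix.mulVec, Function.comp_apply, Matrix.map_apply, Finset.mul_sum, map_sum,
    h.im_conj_mul_map_mul hσφ hσδ, alt_apply, polar_apply, Matrix.toLinearMap₂'_apply, reIm_apply_fst,
    reIm_apply_snd, smul_eq_mul]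
  have e2 : (∑ i, ∑ j, re Ψ (y i) * (im Ψ (x j) * T i j)) = ∑ i, ∑ j, im Ψ (x i) * re Ψ (y j) * T i j := by
    rw [Finset.sum_comm]
    exact Finset.sum_congr rfl fun i _ => Finset.sum_congr rfl fun j _ => by rw [hT' i j]; ring
  rw [e2, ← Finset.sum_sub_distrib]
  refine Finset.sum_congr rfl fun i _ => ?_
  rw [← Finset.sum_sub_distrib]
  exact Finset.sum_congr rfl fun j _ => by ring

/-! ## 5. `U(h) → Sp(Res Sⁿ, im h)` -/

/-- **`resAut g` is symplectic for `g ∈ U(σ, T ⊗ 1)`**: `U(h)` preserves `h`, hence `im h = alt (polar β_T)`.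
The form hypothesis is an equation `H = T.map φ` so that the tree's local / adelic form matrices can be fed in by
rewriting. [cite: MoeglinVignerasWaldspurger1987, Ch. 1 I.17] -/
theorem resAut_mem_symplecticGroup {T : Matrix n n R} (hT : T.IsSymm) {σ : S →+* S} (hσφ : ∀ a, σ (φ a) = φ a)
    (hσδ : σ δ = -δ) {H : Matrix n n S} (hH : H = T.map φ) {g : GL n S} (hg : g ∈ unitaryGroupOfForm σ H) :
    h.resAut n g ∈ symplecticGroup (polar (Matrix.toLinearMap₂' R T)) := by
  rw [symplecticGroup, Heisenberg.PseudoSymplectic.mem_isometries]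
  intro p q
  obtain ⟨x, rfl⟩ := (reIm Ψ n).surjective p
  obtain ⟨y, rfl⟩ := (reIm Ψ n).surjective q
  rw [mem_unitaryGroupOfForm_iff, hH] at hg
  rw [h.resAut_reIm, h.resAut_reIm, ← h.im_hermForm_map n hT hσφ hσδ, ← h.im_hermForm_map n hT hσφ hσδ,
    hermForm_mulVec σ hg]

/-- **`U(σ, H) →* Sp(Rⁿ × Rⁿ, alt (polar β_T))`** for `H = T ⊗ 1`, `Tᵀ = T`: the unitary group of the hermitian
space `(Sⁿ, h)` inside the symplectic group of `(Res_{S/R} Sⁿ, im h)`, in the `R`-rational polarisation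
`Rⁿ · 1 ⊕ Rⁿ · δ`. [cite: GelbartRogawski1991, §3.1 p. 454] -/
def toSymplectic {T : Matrix n n R} (hT : T.IsSymm) {σ : S →+* S} (hσφ : ∀ a, σ (φ a) = φ a) (hσδ : σ δ = -δ)
    {H : Matrix n n S} (hH : H = T.map φ) :
    unitaryGroupOfForm σ H →* symplecticGroup (polar (Matrix.toLinearMap₂' R T)) :=
  ((h.resAut n).restrict (unitaryGroupOfForm σ H)).codRestrict _
    fun g => h.resAut_mem_symplecticGroup n hT hσφ hσδ hH g.2

/-- `toSymplectic g = resAut g` as automorphisms of `Rⁿ × Rⁿ`. [folklore] -/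
@[simp] theorem coe_toSymplectic {T : Matrix n n R} (hT : T.IsSymm) {σ : S →+* S} (hσφ : ∀ a, σ (φ a) = φ a)
    (hσδ : σ δ = -δ) {H : Matrix n n S} (hH : H = T.map φ) (g : unitaryGroupOfForm σ H) :
    ((h.toSymplectic n hT hσφ hσδ hH g : symplecticGroup (polar (Matrix.toLinearMap₂' R T))) :
        ((n → R) × (n → R)) ≃ₗ[R] ((n → R) × (n → R))) = h.resAut n g := rfl

/-- **`toSymplectic g (reIm x) = reIm (g x)`**. [folklore] -/
theorem toSymplectic_reIm {T : Matrix n n R} (hT : T.IsSymm) {σ : S →+* S} (hσφ : ∀ a, σ (φ a) = φ a)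
    (hσδ : σ δ = -δ) {H : Matrix n n S} (hH : H = T.map φ) (g : unitaryGroupOfForm σ H) (x : n → S) :
    (h.toSymplectic n hT hσφ hσδ hH g).1 (reIm Ψ n x) = reIm Ψ n ((g : GL n S) *ᵥ x) :=
  h.resAut_reIm n g x

/-- `toSymplectic` is injective. [folklore] -/
theorem toSymplectic_injective {T : Matrix n n R} (hT : T.IsSymm) {σ : S →+* S} (hσφ : ∀ a, σ (φ a) = φ a)
    (hσδ : σ δ = -δ) {H : Matrix n n S} (hH : H = T.map φ) :
    Function.Injective (h.toSymplectic n hT hσφ hσδ hH) := fun _ _ hgg' =>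
  Subtype.ext (h.resAut_injective n (congrArg Subtype.val hgg'))

end IsQuadraticCoordinates

/-! ## 6. The dual pair `U(h_V) × U(h_W) → U(h_V ⊗ h_W) → Sp` -/

section DualPair

variable {n m : Type*} [Fintype n] [DecidableEq n] [Fintype m] [DecidableEq m]

/-- **`GLₙ(S) × GLₘ(S) →* GL_{n × m}(S)`, `(g, g') ↦ g ⊗ₖ g'`** (`(g h) ⊗ (g' h') = (g ⊗ g') (h ⊗ h')`).
[folklore] -/
def kroneckerGL : GL n S × GL m S →* GL (n × m) S where
  toFun gg :=
    ⟨(gg.1 : Matrix n n S) ⊗ₖ (gg.2 : Matrix m m S), ((gg.1⁻¹ : GL n S) : Matrix n n S) ⊗ₖ ((gg.2⁻¹ : GL m S) : Matrix m m S),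
      by rw [← Matrix.mul_kronecker_mul, ← Units.val_mul, ← Units.val_mul, mul_inv_cancel, mul_inv_cancel,
        Units.val_one, Units.val_one, Matrix.one_kronecker_one],
      by rw [← Matrix.mul_kronecker_mul, ← Units.val_mul, ← Units.val_mul, inv_mul_cancel, inv_mul_cancel,
        Units.val_one, Units.val_one, Matrix.one_kronecker_one]⟩
  map_one' := Units.ext (by simp only [Prod.fst_one, Prod.snd_one, Units.val_one, Matrix.one_kronecker_one])
  map_mul' gg hh := Units.ext (by
    simp only [Prod.fst_mul, Prod.snd_mul, Units.val_mul, Matrix.mul_kronecker_mul])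

/-- Underlying matrix of `kroneckerGL (g, g')`: `g ⊗ₖ g'`. [folklore] -/
@[simp] theorem coe_kroneckerGL (gg : GL n S × GL m S) :
    ((kroneckerGL gg : GL (n × m) S) : Matrix (n × m) (n × m) S) = (gg.1 : Matrix n n S) ⊗ₖ (gg.2 : Matrix m m S) :=
  rfl

omit [Fintype n] [DecidableEq n] [Fintype m] [DecidableEq m] in
/-- `(A ⊗ₖ B).map f = A.map f ⊗ₖ B.map f` for a multiplicative map `f`. [folklore] -/
theorem kronecker_map (f : S →+* S) (A : Matrix n n S) (B : Matrix m m S) :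
    (A ⊗ₖ B).map f = A.map f ⊗ₖ B.map f := by
  ext ⟨i, i'⟩ ⟨j, j'⟩
  simp only [Matrix.map_apply, Matrix.kroneckerMap_apply, map_mul]

omit [Fintype n] [DecidableEq n] [Fintype m] [DecidableEq m] in
/-- `(A ⊗ₖ B)ᵀ = Aᵀ ⊗ₖ Bᵀ`. [folklore] -/
theorem kronecker_transpose (A : Matrix n n S) (B : Matrix m m S) : (A ⊗ₖ B)ᵀ = Aᵀ ⊗ₖ Bᵀ := by
  ext ⟨i, i'⟩ ⟨j, j'⟩
  simp only [Matrix.transpose_apply, Matrix.kroneckerMap_apply]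

/-- **`g ⊗ g' ∈ U(σ, H_V ⊗ₖ H_W)` for `g ∈ U(σ, H_V)`, `g' ∈ U(σ, H_W)`**:
`(σ(g ⊗ g'))ᵀ (H_V ⊗ H_W) (g ⊗ g') = ((σ g)ᵀ H_V g) ⊗ ((σ g')ᵀ H_W g')`. [cite: MoeglinVignerasWaldspurger1987, Ch. 1 I.17] -/
theorem kroneckerGL_mem_unitaryGroupOfForm (σ : S →+* S) {HV : Matrix n n S} {HW : Matrix m m S} {g : GL n S}
    {g' : GL m S} (hg : g ∈ unitaryGroupOfForm σ HV) (hg' : g' ∈ unitaryGroupOfForm σ HW) :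
    kroneckerGL (g, g') ∈ unitaryGroupOfForm σ (HV ⊗ₖ HW) := by
  rw [mem_unitaryGroupOfForm_iff] at hg hg' ⊢
  rw [coe_kroneckerGL, kronecker_map, kronecker_transpose, ← Matrix.mul_kronecker_mul, ← Matrix.mul_kronecker_mul,
    hg, hg']

/-- **The dual pair `U(σ, H_V) × U(σ, H_W) →* U(σ, H_V ⊗ₖ H_W)`**, `(g, g') ↦ g ⊗ g'` (the isometry groups of two
hermitian spaces acting on their tensor product). [cite: MoeglinVignerasWaldspurger1987, Ch. 1 I.17] -/
def dualPair (σ : S →+* S) (HV : Matrix n n S) (HW : Matrix m m S) :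
    unitaryGroupOfForm σ HV × unitaryGroupOfForm σ HW →* unitaryGroupOfForm σ (HV ⊗ₖ HW) :=
  (kroneckerGL.comp ((unitaryGroupOfForm σ HV).subtype.prodMap (unitaryGroupOfForm σ HW).subtype)).codRestrict _
    fun gg => kroneckerGL_mem_unitaryGroupOfForm σ gg.1.2 gg.2.2

/-- Underlying matrix of `dualPair (g, g')`: `g ⊗ₖ g'`. [folklore] -/
@[simp] theorem coe_dualPair (σ : S →+* S) (HV : Matrix n n S) (HW : Matrix m m S)
    (gg : unitaryGroupOfForm σ HV × unitaryGroupOfForm σ HW) :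
    (((dualPair σ HV HW gg : unitaryGroupOfForm σ (HV ⊗ₖ HW)) : GL (n × m) S) : Matrix (n × m) (n × m) S) =
      ((gg.1 : GL n S) : Matrix n n S) ⊗ₖ ((gg.2 : GL m S) : Matrix m m S) :=
  rfl

/-- **The two members of the dual pair commute**: `(g ⊗ 1)(1 ⊗ g') = (1 ⊗ g')(g ⊗ 1)`. [folklore] -/
theorem dualPair_commute (σ : S →+* S) (HV : Matrix n n S) (HW : Matrix m m S) (g : unitaryGroupOfForm σ HV)
    (g' : unitaryGroupOfForm σ HW) : Commute (dualPair σ HV HW (g, 1)) (dualPair σ HV HW (1, g')) := by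
  rw [Commute, SemiconjBy, ← map_mul, ← map_mul, Prod.mk_mul_mk, Prod.mk_mul_mk, one_mul, mul_one, one_mul, mul_one]

/-- `dualPair` is injective on each factor: `g ⊗ 1 = 1 ⇒ g = 1` — stated as injectivity of `g ↦ g ⊗ 1` when `m` is
nonempty. [folklore] -/
theorem dualPair_inl_injective [Nonempty m] (σ : S →+* S) (HV : Matrix n n S) (HW : Matrix m m S) :
    Function.Injective fun g : unitaryGroupOfForm σ HV => dualPair σ HV HW (g, 1) := fun g g' hgg' => by
  obtain ⟨k⟩ := ‹Nonempty m›
  have hm := congrArg (fun u : unitaryGroupOfForm σ (HV ⊗ₖ HW) => ((u : GL (n × m) S) : Matrix (n × m) (n × m) S)) hgg'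
  simp only [coe_dualPair, OneMemClass.coe_one, Units.val_one] at hm
  refine Subtype.ext (Units.ext (Matrix.ext fun i j => ?_))
  have hij := congrFun (congrFun hm (i, k)) (j, k)
  simpa only [Matrix.kroneckerMap_apply, Matrix.one_apply_eq, mul_one] using hij

omit [Fintype n] [DecidableEq n] [Fintype m] [DecidableEq m] in
/-- `(T_V ⊗ 1) ⊗ₖ (T_W ⊗ 1) = (T_V ⊗ₖ T_W) ⊗ 1`: Kronecker products of `R`-rational Gram matrices are `R`-rational.
[folklore] -/
theorem kronecker_map_map (φ : R →+* S) (TV : Matrix n n R) (TW : Matrix m m R) :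
    TV.map φ ⊗ₖ TW.map φ = (TV ⊗ₖ TW).map φ := by
  ext ⟨i, i'⟩ ⟨j, j'⟩
  simp only [Matrix.map_apply, Matrix.kroneckerMap_apply, map_mul]

omit [Fintype n] [DecidableEq n] [Fintype m] [DecidableEq m] in
/-- The Kronecker product of symmetric matrices is symmetric. [folklore] -/
theorem isSymm_kronecker {TV : Matrix n n R} {TW : Matrix m m R} (hV : TV.IsSymm) (hW : TW.IsSymm) :
    (TV ⊗ₖ TW).IsSymm := by
  unfold Matrix.IsSymm at hV hW ⊢
  ext ⟨i, i'⟩ ⟨j, j'⟩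
  have h1 := congrFun (congrFun hV i) j
  have h2 := congrFun (congrFun hW i') j'
  simp only [Matrix.transpose_apply, Matrix.kroneckerMap_apply] at h1 h2 ⊢
  rw [h1, h2]

variable {φ : R →+* S} {Ψ : (R × R) ≃+ S} {δ : S} {d : R}

/-- **The unitary dual pair in the symplectic group**:
`ι : U(σ, T_V ⊗ 1) × U(σ, T_W ⊗ 1) →* Sp((R^{n × m})², alt (polar β_{T_V ⊗ T_W}))`, `(g, g') ↦ Res (g ⊗ g')` — the
group-side datum of the Weil-representation restriction to a unitary dual pair (for `m` a singleton: `U(V) × U(1)`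
acting on `Res_{S/R} V`). [cite: GelbartRogawski1991, §3.1 p. 454] -/
def IsQuadraticCoordinates.dualPairToSymplectic (h : IsQuadraticCoordinates φ Ψ δ d) {TV : Matrix n n R}
    {TW : Matrix m m R} (hV : TV.IsSymm) (hW : TW.IsSymm) {σ : S →+* S} (hσφ : ∀ a, σ (φ a) = φ a)
    (hσδ : σ δ = -δ) {HV : Matrix n n S} {HW : Matrix m m S} (hHV : HV = TV.map φ) (hHW : HW = TW.map φ) :
    unitaryGroupOfForm σ HV × unitaryGroupOfForm σ HW →*
      symplecticGroup (polar (Matrix.toLinearMap₂' R (TV ⊗ₖ TW))) :=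
  (h.toSymplectic (n × m) (isSymm_kronecker hV hW) hσφ hσδ
      (show HV ⊗ₖ HW = (TV ⊗ₖ TW).map φ by rw [hHV, hHW, kronecker_map_map])).comp (dualPair σ HV HW)

/-- **`ι (g, g') (reIm z) = reIm ((g ⊗ g') z)`** on `S^{n × m}`. [folklore] -/
theorem IsQuadraticCoordinates.dualPairToSymplectic_reIm (h : IsQuadraticCoordinates φ Ψ δ d) {TV : Matrix n n R}
    {TW : Matrix m m R} (hV : TV.IsSymm) (hW : TW.IsSymm) {σ : S →+* S} (hσφ : ∀ a, σ (φ a) = φ a)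
    (hσδ : σ δ = -δ) {HV : Matrix n n S} {HW : Matrix m m S} (hHV : HV = TV.map φ) (hHW : HW = TW.map φ)
    (gg : unitaryGroupOfForm σ HV × unitaryGroupOfForm σ HW) (z : n × m → S) :
    (h.dualPairToSymplectic hV hW hσφ hσδ hHV hHW gg).1 (QuadraticCoordinates.reIm Ψ (n × m) z) =
      QuadraticCoordinates.reIm Ψ (n × m)
        ((((gg.1 : GL n S) : Matrix n n S) ⊗ₖ ((gg.2 : GL m S) : Matrix m m S)) *ᵥ z) :=
  h.resAut_reIm (n × m) _ z

/-- The two images of the dual pair in `Sp` commute. [folklore] -/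
theorem IsQuadraticCoordinates.dualPairToSymplectic_commute (h : IsQuadraticCoordinates φ Ψ δ d)
    {TV : Matrix n n R} {TW : Matrix m m R} (hV : TV.IsSymm) (hW : TW.IsSymm) {σ : S →+* S}
    (hσφ : ∀ a, σ (φ a) = φ a) (hσδ : σ δ = -δ) {HV : Matrix n n S} {HW : Matrix m m S} (hHV : HV = TV.map φ)
    (hHW : HW = TW.map φ) (g : unitaryGroupOfForm σ HV) (g' : unitaryGroupOfForm σ HW) :
    Commute (h.dualPairToSymplectic hV hW hσφ hσδ hHV hHW (g, 1))
      (h.dualPairToSymplectic hV hW hσφ hσδ hHV hHW (1, g')) := by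
  rw [Commute, SemiconjBy, ← map_mul, ← map_mul, Prod.mk_mul_mk, Prod.mk_mul_mk, one_mul, mul_one, one_mul, mul_one]

end DualPair

end UnitaryGroup

end Literature.NumberTheory.Automorphic

end
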